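import Summits.CriticalPhenomena.PercolationContinuityZ3.Theorems.PercNearOneGluingNoHeavyQuantFlowUncross
import HarnessLib

/-!
# QUANT lane R8, T-DEC: the CORNER RUN of the flow form of DEC — definitions, the typed CORNER THEOREM, the residual step (LEAD-NOTES-G21 N45)

builds on p205010 (kernel theorem, internal audit signed; external expert review pending)

Statement + support file (`--supports stmt-CriticalPhenomena-4575`), QUANT lane typer seat prim-quant-stmt (gen 23), rung R8 of
`run/shared/lean/prim/quant/LADDER.md`.  Definitions of the corner run (`LawDec.cornerPair/cornerUpdate/cornerFlow/cornerMidFlow/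
cornerResidual/cornerLeftover/CornerSucceeds`), the `@[conjecture]` `LawDec.CornerTheorem`, and theorems with standard axioms, no sorries.
Continues `…QuantFlowUncross` / `…QuantCornerPrelims` / `…QuantCornerStep` (this seat: the exchange moves and the corner STEP).

THE CORNER RUN (lead g21, N45 (2)): process the low atoms `l ≤ j′`, `2l < T` in DECREASING order; ship each to its compatible mids
`h ≤ min(j′, M)`, `T < l + h`, in INCREASING order, each time the amount `min(remaining mass of l, remaining capacity of h / usage(l,h))`;
the leftovers ride the giants `j′+1 ≤ h ≤ M` at the common rate `x/(1−x)`.  Here: stage `n < (j′+1)²` treats the pair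
`cornerPair j′ n = (j′ − n/(j′+1), n % (j′+1))` (lows downwards, mids upwards; inadmissible pairs are no-ops), `cornerFlow n` is the partial
flow after `n` stages (plain `Nat` recursion — induction on `n` is the intended proof principle), `cornerMidFlow` the flow into the mids after
all stages, `cornerResidual F k = μ k − Σ_h F k h − Σ_l usage(l,k)·F l k` the residual instance left by a partial flow `F` (for a low `k` the
second sum vanishes, for an absorber the first), `cornerLeftover l = μ l − Σ_h cornerMidFlow l h`, and
**`CornerSucceeds x T j′ M μ := x/(1−x) · Σ_{lows l} cornerLeftover l ≤ Σ_{j′+1 ≤ h ≤ M} μ h`** — the corner certificate (exact LP optimum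
in 1 675 179 / 1 675 179 census instances, DEC ⟺ corner in 1 182 569 / 1 182 569; kit j135057).
* **`LawDec.CornerTheorem`** (`@[conjecture]`, typed for the next prover): for `0 < x < 1` and a nonnegative law `μ`,
  `FlowAtT x T j′ M μ ↔ CornerSucceeds x T j′ M μ`.  PROOF PLAN (all ingredients in the tree): invariants of `cornerFlow n` by induction on
  `n` (entries `≥ 0`, support on processed admissible pairs, `cornerResidual ≥ 0` and antitone in `n`, and for every processed admissible
  pair `(l,h)`: residual mass of `l` = 0 or residual capacity of `h` = 0); (⟸) the witness is `cornerMidFlow` plus the giant split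
  `leftover(l)·μ h / Σ_giants μ` (`decAtT_of_flowAtT` shape); (⟹) by induction on `n`: `FlowAtT (cornerResidual (cornerFlow n))`, the step
  being `FlowAtT.corner_step` (…QuantCornerStep, hypotheses `hhigh`/`hbelow` = the invariant) followed by `IsFlowAtT.residual` below and
  `cornerResidual_succ`; at the end every low with leftover meets only mids without capacity, so a witness ships the leftovers through the
  giants: `x/(1−x)·Σ leftover ≤ Σ_giants μ`.
* **`IsFlowAtT.residual`** — zeroing the corner entry of a witness gives a witness of the residual instance
  `μ − f l₂ h₁·e_{l₂} − usage(l₂,h₁)·f l₂ h₁·e_{h₁}` (the "remove `l*` or `m*` and recurse" step of N45 (4), uniformly).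
* `cornerFlow_zero/succ`, `cornerUpdate_apply_of_ne` (stages touch one entry), `cornerResidual_zero`.

[this work]; `…QuantLawDecFlows` (typer g22), `…QuantLawDecUsageMonge(Rates)` (lead g21).  Corner (north-west / south-west) rules and Monge
arrays for transportation problems are classical (Hoffman 1963); nothing here is cited as a published result.  The gluing rows served
[cite: KozmaNitzan2024, Conjecture 3 (p. 15)]; product measure [cite: Grimmett1999, §1.3 p. 10].
-/

noncomputable section

namespace Summit.CriticalPhenomena.PercolationContinuityZ3.Theorems

namespace Quant

open Finset

namespace LawDec

/-! ### The corner run -/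

/-- **the pair treated at stage `n` of the corner run**: `(j′ − n/(j′+1), n % (j′+1))` — lows downwards from `j′`, for each low the mids
upwards from `0`. [this work] -/
def cornerPair (j' n : ℕ) : ℕ × ℕ :=
  (j' - n / (j' + 1), n % (j' + 1))

/-- **one stage of the corner run** on the partial flow `F` at the pair `p = (l, h)`: if `l` is low (`2l < T`), `h ≤ M` and `T < l + h`
(compatible mid), the entry `F l h` becomes `min(μ l − Σ_{h'} F l h', (μ h − Σ_{l'} usage(l',h)·F l' h) / usage(l,h))` (remaining mass,
remaining capacity); every other entry, and every inadmissible pair, is untouched. [this work] -/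
def cornerUpdate (x T : ℝ) (j' M : ℕ) (μ : ℕ → ℝ) (F : ℕ → ℕ → ℝ) (p : ℕ × ℕ) : ℕ → ℕ → ℝ :=
  fun l h =>
    if l = p.1 ∧ h = p.2 ∧ 2 * (p.1 : ℝ) < T ∧ p.2 ≤ M ∧ T < (p.1 : ℝ) + p.2 then
      min (μ p.1 - ∑ h' ∈ Finset.range (M + 1), F p.1 h')
        ((μ p.2 - ∑ l' ∈ Finset.range (j' + 1), usage x T j' l' p.2 * F l' p.2) / usage x T j' p.1 p.2)
    else F l h

/-- **the partial corner flow after `n` stages** (`Nat` recursion). [this work] -/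
def cornerFlow (x T : ℝ) (j' M : ℕ) (μ : ℕ → ℝ) : ℕ → ℕ → ℕ → ℝ
  | 0 => fun _ _ => 0
  | n + 1 => cornerUpdate x T j' M μ (cornerFlow x T j' M μ n) (cornerPair j' n)

/-- **the corner flow into the mids**: all `(j′+1)²` stages. [this work] -/
def cornerMidFlow (x T : ℝ) (j' M : ℕ) (μ : ℕ → ℝ) : ℕ → ℕ → ℝ :=
  cornerFlow x T j' M μ ((j' + 1) * (j' + 1))

/-- **the residual instance left by a partial flow `F`**: `μ k − Σ_{h ≤ M} F k h − Σ_{l ≤ j′} usage(l,k)·F l k` (remaining mass of a low,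
remaining capacity of an absorber — for flows supported on (low, compatible mid) pairs one of the two sums vanishes). [this work] -/
def cornerResidual (x T : ℝ) (j' M : ℕ) (μ : ℕ → ℝ) (F : ℕ → ℕ → ℝ) (k : ℕ) : ℝ :=
  μ k - ∑ h ∈ Finset.range (M + 1), F k h - ∑ l ∈ Finset.range (j' + 1), usage x T j' l k * F l k

/-- **the leftover of the low atom `l`** after the corner run through the mids (it rides the giants). [this work] -/
def cornerLeftover (x T : ℝ) (j' M : ℕ) (μ : ℕ → ℝ) (l : ℕ) : ℝ :=
  μ l - ∑ h ∈ Finset.range (M + 1), cornerMidFlow x T j' M μ l h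

/-- **THE CORNER CERTIFICATE**: the leftovers of the low atoms fit into the giants `j′+1 ≤ h ≤ M` at the common rate `x/(1−x)`. [this work] -/
def CornerSucceeds (x T : ℝ) (j' M : ℕ) (μ : ℕ → ℝ) : Prop :=
  x / (1 - x) * ∑ l ∈ (Finset.range (j' + 1)).filter (fun l : ℕ => 2 * (l : ℝ) < T), cornerLeftover x T j' M μ l
    ≤ ∑ h ∈ Finset.Ico (j' + 1) (M + 1), μ h

/-- **THE CORNER THEOREM** (lead g21, LEAD-NOTES-G21 N45 (2)/(4); typed here, proof plan in the file header): for `0 < x < 1` and a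
nonnegative law, the flow form of DEC(j′) at target `T` holds iff the corner run succeeds — DEC has a CANONICAL witness and a
polynomial-size decision procedure with no LP.  Evidence: exact censuses kit j135057 (corner value = LP optimum 1 675 179 / 1 675 179;
DEC ⟺ corner 1 182 569 / 1 182 569).  Ingredients in the tree: `FlowAtT.corner_step` (…QuantCornerStep), `IsFlowAtT.residual`,
`decAtT_of_flowAtT`-type witness building (…QuantLawDecFlowsDecomposition). [this work] [status: open] -/
@[conjecture] def CornerTheorem : Prop :=
  ∀ (x T : ℝ) (j' M : ℕ) (μ : ℕ → ℝ), 0 < x → x < 1 → (∀ k, 0 ≤ μ k) →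
    (FlowAtT x T j' M μ ↔ CornerSucceeds x T j' M μ)

/-! ### Unfolding lemmas -/

/-- stage `0`: the zero flow. -/
theorem cornerFlow_zero (x T : ℝ) (j' M : ℕ) (μ : ℕ → ℝ) : cornerFlow x T j' M μ 0 = fun _ _ => 0 := rfl

/-- stage `n+1`: update stage `n` at `cornerPair j′ n`. -/
theorem cornerFlow_succ (x T : ℝ) (j' M : ℕ) (μ : ℕ → ℝ) (n : ℕ) :
    cornerFlow x T j' M μ (n + 1) = cornerUpdate x T j' M μ (cornerFlow x T j' M μ n) (cornerPair j' n) := rfl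

/-- a stage touches only the entry of its pair. -/
theorem cornerUpdate_apply_of_ne (x T : ℝ) (j' M : ℕ) (μ : ℕ → ℝ) (F : ℕ → ℕ → ℝ) (p : ℕ × ℕ) (l h : ℕ)
    (hne : l ≠ p.1 ∨ h ≠ p.2) : cornerUpdate x T j' M μ F p l h = F l h := by
  unfold cornerUpdate
  rw [if_neg]
  rintro ⟨h1, h2, -⟩
  rcases hne with hne | hne
  · exact hne h1
  · exact hne h2

/-- the value shipped at an admissible stage. -/
theorem cornerUpdate_apply_self (x T : ℝ) (j' M : ℕ) (μ : ℕ → ℝ) (F : ℕ → ℕ → ℝ) (l h : ℕ)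
    (hlow : 2 * (l : ℝ) < T) (hhM : h ≤ M) (hcomp : T < (l : ℝ) + h) :
    cornerUpdate x T j' M μ F (l, h) l h = min (μ l - ∑ h' ∈ Finset.range (M + 1), F l h')
      ((μ h - ∑ l' ∈ Finset.range (j' + 1), usage x T j' l' h * F l' h) / usage x T j' l h) := by
  unfold cornerUpdate
  rw [if_pos ⟨rfl, rfl, hlow, hhM, hcomp⟩]

/-- an inadmissible stage is a no-op. -/
theorem cornerUpdate_of_not_admissible (x T : ℝ) (j' M : ℕ) (μ : ℕ → ℝ) (F : ℕ → ℕ → ℝ) (p : ℕ × ℕ)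
    (h : ¬ (2 * (p.1 : ℝ) < T ∧ p.2 ≤ M ∧ T < (p.1 : ℝ) + p.2)) : cornerUpdate x T j' M μ F p = F := by
  funext l h'
  unfold cornerUpdate
  rw [if_neg]
  rintro ⟨-, -, hrest⟩
  exact h hrest

/-- the residual instance of the zero flow is the law itself. -/
theorem cornerResidual_zero (x T : ℝ) (j' M : ℕ) (μ : ℕ → ℝ) (k : ℕ) :
    cornerResidual x T j' M μ (fun _ _ => 0) k = μ k := by
  simp [cornerResidual]

/-! ### The residual step: zero the corner entry of a witness -/

/-- **ZEROING THE CORNER ENTRY OF A WITNESS GIVES A WITNESS OF THE RESIDUAL INSTANCE** (`l₂` low, `h₁ ≤ M` with `T < l₂ + h₁`): the flow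
`f − f l₂ h₁·e(l₂,h₁)` witnesses the law `μ − f l₂ h₁·e_{l₂} − usage(l₂,h₁)·f l₂ h₁·e_{h₁}`.  With `FlowAtT.corner_step` this is the
recursion step of the corner theorem. [this work] -/
theorem IsFlowAtT.residual {x T : ℝ} {j' M : ℕ} {μ : ℕ → ℝ} {f : ℕ → ℕ → ℝ} (hF : IsFlowAtT x T j' M μ f)
    (l₂ h₁ : ℕ) (hl2 : l₂ ≤ j') (hlow : 2 * (l₂ : ℝ) < T) (hh1M : h₁ ≤ M) (hcomp : T < (l₂ : ℝ) + h₁) :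
    IsFlowAtT x T j' M
      (fun k => μ k - f l₂ h₁ * (if k = l₂ then (1:ℝ) else 0) - usage x T j' l₂ h₁ * f l₂ h₁ * (if k = h₁ then (1:ℝ) else 0))
      (fun l h => f l h - f l₂ h₁ * (if l = l₂ then (1:ℝ) else 0) * (if h = h₁ then (1:ℝ) else 0)) := by
  obtain ⟨hf0, hsupp, hrow, hcol⟩ := hF
  have hlh : (l₂ : ℝ) < h₁ := by linarith
  have hne : l₂ ≠ h₁ := by
    intro h; rw [h] at hlh; exact lt_irrefl _ hlh
  have hl2r : l₂ ∈ Finset.range (j' + 1) := Finset.mem_range.2 (by omega)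
  have val_self : f l₂ h₁ - f l₂ h₁ * (if l₂ = l₂ then (1:ℝ) else 0) * (if h₁ = h₁ then (1:ℝ) else 0) = 0 := by
    rw [if_pos rfl, if_pos rfl]; ring
  have val_other : ∀ l h, ¬ (l = l₂ ∧ h = h₁) →
      f l h - f l₂ h₁ * (if l = l₂ then (1:ℝ) else 0) * (if h = h₁ then (1:ℝ) else 0) = f l h := by
    intro l h hn
    by_cases hl : l = l₂
    · have hh : h ≠ h₁ := fun hh => hn ⟨hl, hh⟩
      rw [if_neg hh]; ring
    · rw [if_neg hl]; ring
  refine ⟨?_, ?_, ?_, ?_⟩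
  · intro l h
    dsimp only
    by_cases hp : l = l₂ ∧ h = h₁
    · rw [hp.1, hp.2, val_self]
    · rw [val_other l h hp]; exact hf0 l h
  · intro l h hpos
    dsimp only at hpos
    by_cases hp : l = l₂ ∧ h = h₁
    · rw [hp.1, hp.2, val_self] at hpos; exact absurd hpos (lt_irrefl _)
    · rw [val_other l h hp] at hpos; exact hsupp l h hpos
  · -- rows: the low `l₂` loses `f l₂ h₁`, the others nothing; no low is `h₁`
    intro l hlj hllow
    dsimp only
    have hlh1 : l ≠ h₁ := by
      intro h
      have : (l : ℝ) = h₁ := by exact_mod_cast h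
      linarith
    have hr := BlobDec2.sum_range_const_indicator M h₁ hh1M (f l₂ h₁ * (if l = l₂ then (1:ℝ) else 0))
    simp only [Finset.sum_sub_distrib]
    rw [hr, hrow l hlj hllow, if_neg hlh1]
    ring
  · -- columns: the absorber `h₁` loses `usage(l₂,h₁)·f l₂ h₁` of load and of capacity; no absorber is `l₂`
    intro h hhM hself
    dsimp only
    have hhl2 : h ≠ l₂ := by
      rintro rfl
      rcases hself with hg | hm
      · omega
      · linarith
    have e : ∀ l, usage x T j' l h * (f l h - f l₂ h₁ * (if l = l₂ then (1:ℝ) else 0) * (if h = h₁ then (1:ℝ) else 0))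
        = usage x T j' l h * f l h
          - (f l₂ h₁ * (if h = h₁ then (1:ℝ) else 0) * usage x T j' l h) * (if l = l₂ then (1:ℝ) else 0) := fun l => by ring
    have hs := sum_mul_indicator_eq _ (fun l => f l₂ h₁ * (if h = h₁ then (1:ℝ) else 0) * usage x T j' l h) l₂ hl2r
    simp only [e, Finset.sum_sub_distrib]
    rw [hs, if_neg hhl2]
    have hold := hcol h hhM hself
    by_cases hh : h = h₁
    · rw [hh] at hold ⊢
      rw [if_pos rfl]
      linarith
    · rw [if_neg hh]
      linarith

/-- the residual instance after one admissible stage on an entry that was `0`: mass of `l` and capacity of `h` drop by the shipped amount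
(times `usage(l,h)` for the capacity), nothing else moves. [this work] -/
theorem cornerResidual_update (x T : ℝ) (j' M : ℕ) (μ : ℕ → ℝ) (F : ℕ → ℕ → ℝ) (l h : ℕ) (hl : l ≤ j') (hhM : h ≤ M)
    (t : ℝ) (k : ℕ) :
    cornerResidual x T j' M μ (fun l' h' => F l' h' + t * (if l' = l then (1:ℝ) else 0) * (if h' = h then (1:ℝ) else 0)) k
      = cornerResidual x T j' M μ F k - t * (if k = l then (1:ℝ) else 0) - usage x T j' l k * t * (if k = h then (1:ℝ) else 0) := by
  unfold cornerResidual
  have hlr : l ∈ Finset.range (j' + 1) := Finset.mem_range.2 (by omega)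
  have hr := BlobDec2.sum_range_const_indicator M h hhM (t * (if k = l then (1:ℝ) else 0))
  have e : ∀ l', usage x T j' l' k * (F l' k + t * (if l' = l then (1:ℝ) else 0) * (if k = h then (1:ℝ) else 0))
      = usage x T j' l' k * F l' k + (t * (if k = h then (1:ℝ) else 0) * usage x T j' l' k) * (if l' = l then (1:ℝ) else 0) :=
    fun l' => by ring
  have hs := sum_mul_indicator_eq _ (fun l' => t * (if k = h then (1:ℝ) else 0) * usage x T j' l' k) l hlr
  simp only [e, Finset.sum_add_distrib]
  rw [hr, hs]
  ring

end LawDec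

end Quant

end Summit.CriticalPhenomena.PercolationContinuityZ3.Theorems
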